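import Summits.AnomalousDissipation.AnomalousDissipation.Theses.SolenoidalFractalHomogenisation
import Mathlib.Analysis.SpecificLimits.Basic
import HarnessLib

/-!
# The arithmetic half of the crux `PermissibleFractalCarrier`: bookkeeping sequences inside the window
(route `AnomalousDissipation/SolenoidalFractalHomogenisation`, crux K3 = stmt-AnomalousDissipation-19073, registered
stub `stub_bookkeeping` of the planner's BC3 birth skeleton `Cruxes.PermissibleFractalCarrier.Birth`; support seat
ad-sawtooth-support g7, cell ad-ideate)

For every word design `W`, constants `c, ν₀, K > 0` and minimal separation `Λ₀` we exhibit EXPLICIT sequences making a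
`FractalCarrierData` that is `Permissible`, obeys the amplitude law `a_m ≤ N_m^{7/8}` and the separation `Λ₀ N_m ≤ N_{m+1}`:
with one integer `r ≥ 2` (large in terms of `Λ₀, K²/c, c/ν₀², 1/c`) put
`N_m = r^{2m}`, `a_m = r^m`, `kbar_m = κ₀ r^{-3m}`, `κ₀ = √(c/(r³ − 1))`.
Then the cell viscosity is constant, `cellVisc m = κ₀ < ν₀`; the Taylor recursion holds with the constant cell gain
`c a²/(kbar² N⁴) = r³ − 1`; the separation `N_{m+1}/N_m = r² ≥ ⌈K/κ₀⌉` because `K²/c ≤ r/4`; the finer levels are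
viscous-dominated since `kbar_j N_m²/a_m = κ₀ r^{3(m−j)} ≥ κ₀ r³ ≥ 1`; the physical periods are commensurable with ratio
exactly `r`; and `kbar_m → 0` geometrically.
-/

set_option linter.dupNamespace false

noncomputable section

namespace Summit.AnomalousDissipation.AnomalousDissipation.Theorems.SolenoidalFractalHomogenisation.PermissibleCarrier

open Filter Topology
open Literature.Analysis.FluidPDE
open Literature.Analysis.FluidPDE.LatticeShear

/-- The period of a stretched word is the stretch factor times the period. [folklore] -/
theorem period_stretch {k : ℕ} (W : LatticeWord k) (s : ℝ) (hs : 0 < s) :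
    (W.stretch s hs).period = s * W.period := by
  unfold LatticeWord.period LatticeWord.stretch
  simp [Finset.mul_sum]

/-- **Registered stub `stub_bookkeeping` of the crux `PermissibleFractalCarrier` (K3).** For every word design `W`,
constants `c, ν₀, K > 0` and every prescribed minimal scale separation `Λ₀` there is a fractal-carrier datum replaying `W`
with recursion constant `c` and regime data `(ν₀, K)` which is `Permissible` (nested lattices `N_m = r^{2m}`, Taylor
recursion with constant cell gain `r³ − 1`, quasi-static levels `cellVisc ≡ κ₀ < ν₀`, separation beating `⌈K/cellVisc⌉`,
finer levels viscous-dominated, commensurable periods with ratio `r`, `kbar_m = κ₀ r^{−3m} → 0`), with the amplitude law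
`a_m = r^m ≤ N_m^{7/8}` and `Λ₀ N_m ≤ N_{m+1}`. [cite: ArmstrongVicol2025, §3 (3.42)–(3.43) (parameter bookkeeping window)] -/
theorem stub_bookkeeping : ∀ k (W : LatticeShear.LatticeWord k) (c ν₀ K : ℝ) (Λ₀ : ℕ), 0 < c → 0 < ν₀ → 0 < K →
    ∃ D : LatticeShear.FractalCarrierData k, D.design = W ∧ D.gain = c ∧ D.nu0 = ν₀ ∧ D.K = K ∧ D.Permissible ∧
      (∀ m, D.a m ≤ (D.N m : ℝ) ^ (7 / 8 : ℝ)) ∧ ∀ m, Λ₀ * D.N m ≤ D.N (m + 1) := by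
  intro k W c ν₀ K Λ₀ hc hν₀ hK
  -- one large integer `r`
  obtain ⟨r, hr⟩ := exists_nat_ge (max (max (2 : ℝ) Λ₀) (max (4 * K ^ 2 / c) (max (c / ν₀ ^ 2 + 2) (1 / c + 1))))
  have hr2 : (2 : ℝ) ≤ r := le_trans (le_trans (le_max_left _ _) (le_max_left _ _)) hr
  have hrΛ : (Λ₀ : ℝ) ≤ r := le_trans (le_trans (le_max_right _ _) (le_max_left _ _)) hr
  have hrK : 4 * K ^ 2 / c ≤ r := le_trans (le_trans (le_max_left _ _) (le_max_right _ _)) hr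
  have hrν : c / ν₀ ^ 2 + 2 ≤ r :=
    le_trans (le_trans (le_trans (le_max_left _ _) (le_max_right _ _)) (le_max_right _ _)) hr
  have hrc : 1 / c + 1 ≤ r :=
    le_trans (le_trans (le_trans (le_max_right _ _) (le_max_right _ _)) (le_max_right _ _)) hr
  have hr1 : (1 : ℝ) ≤ r := by linarith
  have hr0 : (0 : ℝ) < r := by linarith
  have hrn2 : 2 ≤ r := by exact_mod_cast hr2
  have hrn1 : 1 ≤ r := le_trans (by norm_num) hrn2
  have hrn0 : 0 < r := lt_of_lt_of_le (by norm_num) hrn2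
  -- the ratio `ρ = r³` of consecutive renormalised viscosities and the constant cell viscosity `κ₀`
  set ρ : ℝ := (r : ℝ) ^ 3 with hρ
  have hρr : (r : ℝ) ≤ ρ := by
    rw [hρ]
    calc (r : ℝ) = (r : ℝ) ^ 1 := (pow_one _).symm
      _ ≤ (r : ℝ) ^ 3 := pow_le_pow_right₀ hr1 (by norm_num)
  have hρ1 : 1 < ρ := by linarith
  have hρ0 : 0 < ρ := by linarith
  have hg0 : 0 < ρ - 1 := by linarith
  set κ₀ : ℝ := Real.sqrt (c / (ρ - 1)) with hκ₀
  have hκ₀pos : 0 < κ₀ := Real.sqrt_pos.2 (div_pos hc hg0)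
  have hκ₀sq : κ₀ ^ 2 = c / (ρ - 1) := Real.sq_sqrt (div_pos hc hg0).le
  -- casts of the lattice sizes
  have hNcast : ∀ m : ℕ, ((r ^ (2 * m) : ℕ) : ℝ) = (r : ℝ) ^ (2 * m) := fun m => by push_cast; ring
  have hρm : ∀ m : ℕ, ρ ^ m = (r : ℝ) ^ (3 * m) := fun m => by rw [hρ, ← pow_mul]
  refine ⟨⟨W, c, ν₀, K, fun m => r ^ (2 * m), fun m => (r : ℝ) ^ m, fun m => κ₀ / ρ ^ m, hc, hν₀, hK,
    fun m => pow_pos hrn0 _, fun m => pow_pos hr0 _, fun m => div_pos hκ₀pos (pow_pos hρ0 _)⟩,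
    rfl, rfl, rfl, rfl, ?_, ?_, ?_⟩
  · -- `Permissible`
    -- the cell viscosity is the constant `κ₀`
    have hcv : ∀ m : ℕ, LatticeShear.FractalCarrierData.cellVisc
        ⟨W, c, ν₀, K, fun m => r ^ (2 * m), fun m => (r : ℝ) ^ m, fun m => κ₀ / ρ ^ m, hc, hν₀, hK,
          fun m => pow_pos hrn0 _, fun m => pow_pos hr0 _, fun m => div_pos hκ₀pos (pow_pos hρ0 _)⟩ m = κ₀ := by
      intro m
      unfold LatticeShear.FractalCarrierData.cellVisc
      simp only [hNcast, hρm]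
      have h1 : (r : ℝ) ^ (3 * m) ≠ 0 := pow_ne_zero _ hr0.ne'
      have h2 : (r : ℝ) ^ m ≠ 0 := pow_ne_zero _ hr0.ne'
      rw [div_eq_iff h2, div_mul_eq_mul_div, div_eq_iff h1]
      rw [← pow_mul, show 2 * m * 2 = m + 3 * m by ring, pow_add]
      ring
    -- the physical period of level `m` is `W.period / (κ₀ r^m)`
    have hpp : ∀ m : ℕ, LatticeShear.FractalCarrierData.physPeriod
        ⟨W, c, ν₀, K, fun m => r ^ (2 * m), fun m => (r : ℝ) ^ m, fun m => κ₀ / ρ ^ m, hc, hν₀, hK,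
          fun m => pow_pos hrn0 _, fun m => pow_pos hr0 _, fun m => div_pos hκ₀pos (pow_pos hρ0 _)⟩ m =
        W.period / (κ₀ * (r : ℝ) ^ m) := by
      intro m
      have hc' := hcv m
      unfold LatticeShear.FractalCarrierData.physPeriod LatticeShear.FractalCarrierData.word
        LatticeShear.FractalCarrierData.slotStretch
      rw [period_stretch]
      unfold LatticeShear.FractalCarrierData.cellVisc at hc' ⊢
      rw [hc']
      simp only []
      have h2 : (r : ℝ) ^ m ≠ 0 := pow_ne_zero _ hr0.ne'
      field_simp
    refine ⟨by simp, fun m => pow_dvd_pow r (by omega), fun m => ?_, fun m => ?_, fun m _ => ?_, fun m => ?_,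
      fun j m hj hjm => ?_, fun m => ?_, ?_⟩
    · -- `2 N_m ≤ N_{m+1}`
      show 2 * r ^ (2 * m) ≤ r ^ (2 * (m + 1))
      rw [show 2 * (m + 1) = 2 * m + 2 by ring, pow_add]
      rw [mul_comm]
      exact Nat.mul_le_mul_left _ (le_trans (by norm_num) (Nat.pow_le_pow_left hrn2 2))
    · -- Taylor recursion with constant cell gain `ρ - 1`
      show κ₀ / ρ ^ m = κ₀ / ρ ^ (m + 1) *
        (1 + c * ((r : ℝ) ^ (m + 1)) ^ 2 / ((κ₀ / ρ ^ (m + 1)) ^ 2 * ((r ^ (2 * (m + 1)) : ℕ) : ℝ) ^ 4))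
      have hgain : c * ((r : ℝ) ^ (m + 1)) ^ 2 / ((κ₀ / ρ ^ (m + 1)) ^ 2 * ((r ^ (2 * (m + 1)) : ℕ) : ℝ) ^ 4) =
          ρ - 1 := by
        rw [hNcast, div_pow, hκ₀sq, hρm]
        set X : ℝ := (r : ℝ) ^ (m + 1) with hX
        have hX0 : X ≠ 0 := pow_ne_zero _ hr0.ne'
        have e3 : (r : ℝ) ^ (3 * (m + 1)) = X ^ 3 := by rw [hX, ← pow_mul, mul_comm]
        have e2 : (r : ℝ) ^ (2 * (m + 1)) = X ^ 2 := by rw [hX, ← pow_mul, mul_comm]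
        rw [e3, e2]
        have hg0' : ρ - 1 ≠ 0 := hg0.ne'
        field_simp
      rw [hgain, show (1 : ℝ) + (ρ - 1) = ρ by ring, pow_succ]
      have hρm0 : ρ ^ m ≠ 0 := pow_ne_zero _ hρ0.ne'
      field_simp
    · -- quasi-static levels: `cellVisc m = κ₀ < ν₀`
      rw [hcv m]
      show κ₀ < ν₀
      rw [hκ₀, show ν₀ = Real.sqrt (ν₀ ^ 2) by rw [Real.sqrt_sq hν₀.le]]
      refine Real.sqrt_lt_sqrt (div_pos hc hg0).le ?_
      rw [div_lt_iff₀ hg0]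
      have h1 : c / ν₀ ^ 2 < ρ - 1 := by linarith
      have h2 := (div_lt_iff₀ (pow_pos hν₀ 2)).1 h1
      linarith
    · -- separation beating the homogenisation threshold: `⌈K/κ₀⌉ N_m ≤ N_{m+1}`
      rw [hcv (m + 1)]
      show ((⌈K / κ₀⌉₊ : ℕ) : ℝ) * ((r ^ (2 * m) : ℕ) : ℝ) ≤ ((r ^ (2 * (m + 1)) : ℕ) : ℝ)
      have hceil : ⌈K / κ₀⌉₊ ≤ r ^ 2 := by
        refine Nat.ceil_le.2 ?_
        push_cast
        rw [div_le_iff₀ hκ₀pos]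
        -- `K ≤ r² κ₀` since `K² (ρ - 1) ≤ K² r³ ≤ c r⁴`
        have hK2 : K ^ 2 ≤ (r : ℝ) * c / 4 := by
          have := (div_le_iff₀ hc).1 hrK
          linarith
        have hsq : K ^ 2 ≤ ((r : ℝ) ^ 2 * κ₀) ^ 2 := by
          rw [mul_pow, hκ₀sq, ← pow_mul, ← mul_div_assoc, le_div_iff₀ hg0]
          have : ρ - 1 ≤ (r : ℝ) ^ 3 := by linarith
          calc K ^ 2 * (ρ - 1) ≤ ((r : ℝ) * c / 4) * (r : ℝ) ^ 3 :=
                mul_le_mul hK2 this hg0.le (by positivity)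
            _ ≤ (r : ℝ) ^ (2 * 2) * c := by
                rw [show (2 * 2 : ℕ) = 4 by norm_num]
                nlinarith [pow_pos hr0 4, hc]
        exact (pow_le_pow_iff_left₀ hK.le (by positivity) two_ne_zero).1 hsq
      have hnat : ⌈K / κ₀⌉₊ * r ^ (2 * m) ≤ r ^ (2 * (m + 1)) :=
        calc ⌈K / κ₀⌉₊ * r ^ (2 * m) ≤ r ^ 2 * r ^ (2 * m) := Nat.mul_le_mul_right _ hceil
          _ = r ^ (2 * (m + 1)) := by rw [← pow_add]; ring_nf
      exact_mod_cast hnat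
    · -- finer levels viscous-dominated: `1 ≤ kbar_j N_m² / a_m = κ₀ r^{3(m-j)}`
      show (1 : ℝ) ≤ κ₀ / ρ ^ j * ((r ^ (2 * m) : ℕ) : ℝ) ^ 2 / (r : ℝ) ^ m
      obtain ⟨d, rfl⟩ := Nat.exists_eq_add_of_lt hjm
      rw [hNcast, hρm]
      have e : κ₀ / (r : ℝ) ^ (3 * j) * ((r : ℝ) ^ (2 * (j + d + 1))) ^ 2 / (r : ℝ) ^ (j + d + 1) =
          κ₀ * (r : ℝ) ^ (3 * (d + 1)) := by
        have h1 : (r : ℝ) ^ (3 * j) ≠ 0 := pow_ne_zero _ hr0.ne'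
        have h2 : (r : ℝ) ^ (j + d + 1) ≠ 0 := pow_ne_zero _ hr0.ne'
        rw [div_mul_eq_mul_div, div_div, div_eq_iff (mul_ne_zero h1 h2)]
        rw [← pow_mul, show κ₀ * (r : ℝ) ^ (3 * (d + 1)) * ((r : ℝ) ^ (3 * j) * (r : ℝ) ^ (j + d + 1)) =
          κ₀ * ((r : ℝ) ^ (3 * (d + 1)) * (r : ℝ) ^ (3 * j) * (r : ℝ) ^ (j + d + 1)) by ring,
          ← pow_add, ← pow_add]
        ring_nf
      rw [e]
      -- `κ₀ r³ ≥ 1` because `c ρ ≥ 1`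
      have h3 : (r : ℝ) ^ 3 ≤ (r : ℝ) ^ (3 * (d + 1)) := pow_le_pow_right₀ hr1 (by omega)
      have hcρ : 1 ≤ c * ρ := by
        have h1 : 1 / c ≤ (r : ℝ) := by linarith
        have h2 : 1 ≤ c * (r : ℝ) := by
          have := (div_le_iff₀ hc).1 h1
          linarith
        nlinarith [hρr, hc]
      have hk3 : 1 ≤ κ₀ * (r : ℝ) ^ 3 := by
        -- square: `κ₀² ρ² = c ρ²/(ρ-1) ≥ c ρ ≥ 1`
        have hsq : 1 ≤ (κ₀ * (r : ℝ) ^ 3) ^ 2 := by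
          rw [mul_pow, hκ₀sq, ← hρ, div_mul_eq_mul_div, le_div_iff₀ hg0]
          nlinarith [hcρ, hρ1, hc]
        nlinarith [hsq, mul_pos hκ₀pos (pow_pos hr0 3)]
      calc (1 : ℝ) ≤ κ₀ * (r : ℝ) ^ 3 := hk3
        _ ≤ κ₀ * (r : ℝ) ^ (3 * (d + 1)) := mul_le_mul_of_nonneg_left h3 hκ₀pos.le
    · -- commensurable periods with ratio `r`
      refine ⟨r, hrn0, ?_⟩
      rw [hpp, hpp]
      have h2 : (r : ℝ) ^ m ≠ 0 := pow_ne_zero _ hr0.ne'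
      have h3 : (r : ℝ) ^ (m + 1) ≠ 0 := pow_ne_zero _ hr0.ne'
      field_simp
      ring
    · -- `kbar_m → 0`
      show Tendsto (fun m => κ₀ / ρ ^ m) atTop (𝓝 0)
      have h := (tendsto_pow_atTop_nhds_zero_of_lt_one (inv_nonneg.2 hρ0.le) (inv_lt_one_of_one_lt₀ hρ1)).const_mul κ₀
      rw [mul_zero] at h
      refine h.congr' (Eventually.of_forall fun m => ?_)
      simp [div_eq_mul_inv, inv_pow]
  · -- amplitude law `a_m = r^m ≤ N_m^{7/8} = r^{7m/4}`
    intro m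
    show (r : ℝ) ^ m ≤ (((r ^ (2 * m) : ℕ) : ℝ)) ^ (7 / 8 : ℝ)
    rw [hNcast, ← Real.rpow_natCast, ← Real.rpow_natCast, ← Real.rpow_mul hr0.le]
    refine Real.rpow_le_rpow_of_exponent_le hr1 ?_
    push_cast
    have : (0 : ℝ) ≤ m := Nat.cast_nonneg m
    linarith
  · -- prescribed separation `Λ₀ N_m ≤ N_{m+1}`
    intro m
    show Λ₀ * r ^ (2 * m) ≤ r ^ (2 * (m + 1))
    have hΛ : Λ₀ ≤ r ^ 2 := by
      have h1 : (Λ₀ : ℝ) ≤ (r : ℝ) ^ 2 := by nlinarith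
      exact_mod_cast h1
    calc Λ₀ * r ^ (2 * m) ≤ r ^ 2 * r ^ (2 * m) := Nat.mul_le_mul_right _ hΛ
      _ = r ^ (2 * (m + 1)) := by rw [← pow_add]; ring_nf

end Summit.AnomalousDissipation.AnomalousDissipation.Theorems.SolenoidalFractalHomogenisation.PermissibleCarrier

end
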